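import Summits.HubbardSuperconductivity.HubbardSuperconductivity.Theorems.WeakCouplingBCSKlLindhardEnclosureCos

/-!
# KL-MARGIN-SCAN reader idea-4 (lens «cascade»), round 11 «kernel-lindhard-enclosure» — CORE part 2/4: §2 Parameters, grid records, cosine ranges

Part 2/4 of `r11/Core.lean` (sha16 2ed93ab82e33da2d; crux idea on `stmt-HubbardSuperconductivity-0158`; author hubbard-klscan-idea-4 g11; graded by
hubbard-klscan-crit-1 g3): the 1 110-line Core is split into four modules because the gate caps a Theorems file with proofs at 400 lines; content VERBATIM
(packaging: gate-hubbard-kl-p1 g24).  Enclosures/confirmations hold MODULO the typed, unproved `FloorSoundAt`/`CeilSoundAt`; floats are floats; nothing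
here asserts a KL margin at any `t′ ≠ 0`, `K₃`, `U₀`, the window or B1g dominance; a Kohn–Luttinger instability statement is not ODLRO and nothing in this
file proves superconductivity in the Hubbard model.
-/

noncomputable section

set_option linter.dupNamespace false

namespace Summit.HubbardSuperconductivity.HubbardSuperconductivity.Theorems.KlLindhardEnclosure

open Real Set MeasureTheory Literature.MathematicalPhysics.QuantumLattice
open Summit.HubbardSuperconductivity.HubbardSuperconductivity.Theorems
open Summit.HubbardSuperconductivity.HubbardSuperconductivity.Theorems.FSPoly (cosTaylorQ cosLoQ cosUpQ piLoQ cosLoQ_le_cos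
  cos_le_cosUpQ cast_cosTaylorQ)
open Summit.HubbardSuperconductivity.HubbardSuperconductivity.Theorems.KlStair (bandQ bandR piUpQ cast_bandQ
  squareDispersion_eq_bandR pi_lt_piUpQ)

/-! ## §2 Parameters, grid records, cosine ranges -/

/-- Certificate parameters: band `t′ = tpN/tpD`, chemical potential `μ = muN/muD`, transfer momentum `q = (q1z, q2z)/U`, grid unit `1/U`,
ROOT half-width `Xz/U` (the root square must COVER `[−π, π)²`: `piUpZ ≤ Xz`), and the claimed integer brackets `piLoZ < πU < piUpZ`
(checked in `admissible` against `FSPoly.piLoQ < π < KlStair.piUpQ`). [folklore] -/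
structure Params where
  /-- numerator of `t′` -/
  tpN : ℤ
  /-- denominator of `t′` (positive) -/
  tpD : ℤ
  /-- numerator of `μ` -/
  muN : ℤ
  /-- denominator of `μ` (positive) -/
  muD : ℤ
  /-- transfer momentum, first coordinate, in units `1/U` -/
  q1z : ℤ
  /-- transfer momentum, second coordinate, in units `1/U` -/
  q2z : ℤ
  /-- half-width of the ROOT square in units `1/U` (`≥ piUpZ`) -/
  Xz : ℤ
  /-- grid unit denominator `U` -/
  U : ℤ
  /-- claimed `piLoZ ≤ piLoQ · U` (so `piLoZ < π U`) -/
  piLoZ : ℤ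
  /-- claimed `piUpQ · U ≤ piUpZ` (so `π U < piUpZ`) -/
  piUpZ : ℤ

/-- `t′` as a rational. [folklore] -/
def Params.tp (P : Params) : ℚ := (P.tpN : ℚ) / (P.tpD : ℚ)
/-- `μ` as a rational. [folklore] -/
def Params.mu (P : Params) : ℚ := (P.muN : ℚ) / (P.muD : ℚ)
/-- Integer grid coordinate ↦ rational coordinate `z/U`. [folklore] -/
def Params.toQ (P : Params) (z : ℤ) : ℚ := (z : ℚ) / (P.U : ℚ)
/-- `q₁` as a rational. [folklore] -/
def Params.q1 (P : Params) : ℚ := P.toQ P.q1z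
/-- `q₂` as a rational. [folklore] -/
def Params.q2 (P : Params) : ℚ := P.toQ P.q2z

/-- GRID RECORD for an abscissa `x = z/U`: integer numerators over `D` of `cos x` (below/above) and `cos (x + q)` (below/above). Built ONCE per
grid abscissa by `QB.eval` and shared by all descendant cells. [folklore] -/
structure Pt where
  /-- grid coordinate (units `1/U`) -/
  z : ℤ
  /-- `≤ D cos x` -/
  lo : ℤ
  /-- `≥ D cos x` -/
  hi : ℤ
  /-- `≤ D cos (x + q)` -/
  lo' : ℤ
  /-- `≥ D cos (x + q)` -/
  hi' : ℤ

/-- Build the abscissa record at grid coordinate `z` (shift `q₁`): integer fixed-point Taylor floors/ceilings of degree 14/16 at `z/U` and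
18/20 at `(z + q₁)/U` (values identical to `flZ (cosLoQ _)`, `clZ (cosUpQ _)`, `flZ (cosLo9 _)`, `clZ (cosUp10 _)`; computed without `ℚ`). [folklore] -/
def Params.mkX (P : Params) (z : ℤ) : Pt :=
  ⟨z, cosFlZ 7 z P.U, cosClZ 8 z P.U, cosFlZ 9 (z + P.q1z) P.U, cosClZ 10 (z + P.q1z) P.U⟩

/-- Build the ordinate record at grid coordinate `z` (shift `q₂`). [folklore] -/
def Params.mkY (P : Params) (z : ℤ) : Pt :=
  ⟨z, cosFlZ 7 z P.U, cosClZ 8 z P.U, cosFlZ 9 (z + P.q2z) P.U, cosClZ 10 (z + P.q2z) P.U⟩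

/-- Projection computation rule used when assembling split certificates. [folklore] -/
theorem Params.mkX_z (P : Params) (z : ℤ) : (P.mkX z).z = z := rfl
/-- Projection computation rule used when assembling split certificates. [folklore] -/
theorem Params.mkY_z (P : Params) (z : ℤ) : (P.mkY z).z = z := rfl

/-- May the abscissa interval `[u0, u1]/U` (`|u| ≤ 2πU`) contain an ODD multiple of `π` (a minimiser of `cos`)? Conservative. [folklore] -/
def Params.mayMinZ (P : Params) (u0 u1 : ℤ) : Bool :=
  (decide (u0 < P.piUpZ) && decide (P.piLoZ < u1)) || (decide (u0 < -P.piLoZ) && decide (-P.piUpZ < u1)) ||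
    decide (3 * P.piLoZ ≤ u1) || decide (u0 ≤ -(3 * P.piLoZ))

/-- May `[u0, u1]/U` (`|u| ≤ 2πU`) contain an EVEN multiple of `π` (a maximiser of `cos`)? Conservative. [folklore] -/
def Params.mayMaxZ (P : Params) (u0 u1 : ℤ) : Bool :=
  (decide (u0 ≤ 0) && decide (0 ≤ u1)) || (decide (u0 < 2 * P.piUpZ) && decide (2 * P.piLoZ < u1)) ||
    (decide (u0 < -(2 * P.piLoZ)) && decide (-(2 * P.piUpZ) < u1))

/-- Lower bound (over `D`) of `cos` on `[u0, u1]/U` from endpoint minorants. [folklore] -/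
def Params.cosInfZ (P : Params) (u0 u1 l0 l1 : ℤ) : ℤ := if P.mayMinZ u0 u1 then -D else min l0 l1

/-- Upper bound (over `D`) of `cos` on `[u0, u1]/U` from endpoint majorants. [folklore] -/
def Params.cosSupZ (P : Params) (u0 u1 h0 h1 : ℤ) : ℤ := if P.mayMaxZ u0 u1 then D else max h0 h1

/-- Is `cos` certified MONOTONE on `[u0, u1]/U`? `some true` = decreasing (inside `[0, π]` or `[−2π, −π]`, where `sin ≥ 0`), `some false` =
increasing (inside `[−π, 0]` or `[π, 2π]`, where `sin ≤ 0`). [folklore] -/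
def Params.cosDirZ (P : Params) (u0 u1 : ℤ) : Option Bool :=
  if (decide (0 ≤ u0) && decide (u1 ≤ P.piLoZ)) || (decide (u1 ≤ -P.piUpZ) && decide (-(2 * P.piLoZ) ≤ u0)) then some true
  else if (decide (-P.piLoZ ≤ u0) && decide (u1 ≤ 0)) || (decide (P.piUpZ ≤ u0) && decide (u1 ≤ 2 * P.piLoZ)) then some false
  else none

/-- INNER enclosure `[c0, c1]/D ⊆ cos '' [u0, u1]/U` when `cos` is certified monotone there (floor boundary rule, round 10). [folklore] -/
def Params.cosInnerZ (P : Params) (u0 u1 l0 h0 l1 h1 : ℤ) : Option (ℤ × ℤ) :=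
  match P.cosDirZ u0 u1 with
  | some true => some (h1, l0)
  | some false => some (h0, l1)
  | none => none

/-- Lower bound (over `D`) of `|cos|` on an interval from an OUTER range `[lo, hi]/D`. [folklore] -/
def absLoZ (lo hi : ℤ) : ℤ := if lo ≤ 0 ∧ 0 ≤ hi then 0 else min |lo| |hi|

/-- Upper bound (over `D`) of `|cos|` from an outer range. [folklore] -/
def absHiZ (lo hi : ℤ) : ℤ := max |lo| |hi|

/-- CHECK an upper |sin| hint `σ` (units `10⁻⁴`) against an outer cosine range: `1 − (min|cos|)² ≤ σ²`. [folklore] -/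
def sinHiOK (lo hi : ℤ) (σ : ℕ) : Bool := decide ((D ^ 2 - absLoZ lo hi ^ 2) * 10 ^ 8 ≤ (σ : ℤ) ^ 2 * D ^ 2)

/-- CHECK a lower |sin| hint `τ` (units `10⁻⁴`) against an outer cosine range: `τ² ≤ 1 − (max|cos|)²`. (A range touching `±1` forces `τ = 0`.)
[folklore] -/
def sinLoOK (lo hi : ℤ) (τ : ℕ) : Bool := decide ((τ : ℤ) ^ 2 * D ^ 2 ≤ (D ^ 2 - absHiZ lo hi ^ 2) * 10 ^ 8)

/-- Newton iteration from above for `⌊√v⌋` (`fuel` steps; the result is only ever used through the CHECKS `sinHiOK/sinLoOK`,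
so soundness never depends on it). [folklore] -/
def isqrtAux : ℕ → ℤ → ℤ → ℤ
  | 0, _, g => g
  | fuel + 1, v, g =>
    let g' := (g + v / g) / 2
    if g' < g then isqrtAux fuel v g' else g

/-- `⌊√v⌋` for `0 ≤ v ≤ 10⁸` (start `10001`, 40 steps). [folklore] -/
def isqrtZ (v : ℤ) : ℤ := isqrtAux 40 v 10001

/-- AUTOMATIC upper |sin| hint (units `10⁻⁴`) from an outer cosine range: the least `σ` with `sinHiOK lo hi σ`. [folklore] -/
def sigmaAuto (lo hi : ℤ) : ℕ :=
  let v := cdivZ ((D ^ 2 - absLoZ lo hi ^ 2) * 10 ^ 8) (D ^ 2)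
  let s := isqrtZ v
  (if s * s < v then s + 1 else s).toNat

/-- AUTOMATIC lower |sin| hint (units `10⁻⁴`): the largest `τ` with `sinLoOK lo hi τ` (if Newton converged; else the check fails safely). [folklore] -/
def tauAuto (lo hi : ℤ) : ℕ :=
  let v := fdivZ ((D ^ 2 - absHiZ lo hi ^ 2) * 10 ^ 8) (D ^ 2)
  if v ≤ 0 then 0 else (isqrtZ v).toNat

/-- Monotonicity guard for an enclosure numerator `c`: `−2 < 4 t′ c/D`. [folklore] -/
def Params.guard (P : Params) (c : ℤ) : Bool := decide (-2 * D * P.tpD < 4 * P.tpN * c)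

/-- UPPER integer enclosure (over `D`) of the band `−2(a+b) − 4t′ab` at value numerators `a, b`. [folklore] -/
def Params.bandUpZ (P : Params) (a b : ℤ) : ℤ := -2 * (a + b) - fdivZ (4 * P.tpN * a * b) (P.tpD * D)

/-- LOWER integer enclosure (over `D`) of the band at value numerators `a, b`. [folklore] -/
def Params.bandDnZ (P : Params) (a b : ℤ) : ℤ := -2 * (a + b) - cdivZ (4 * P.tpN * a * b) (P.tpD * D)

/-- `v/D < μ`. [folklore] -/
def Params.ltMu (P : Params) (v : ℤ) : Bool := decide (v * P.muD < P.muN * D)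
/-- `μ ≤ v/D`. [folklore] -/
def Params.muLe (P : Params) (v : ℤ) : Bool := decide (P.muN * D ≤ v * P.muD)
/-- `⌊D μ⌋`. [folklore] -/
def Params.muFl (P : Params) : ℤ := fdivZ (P.muN * D) P.muD
/-- `⌈D μ⌉`. [folklore] -/
def Params.muCl (P : Params) : ℤ := cdivZ (P.muN * D) P.muD

/-- `1 + 2t′c/D` (numerator over `D`) rounded DOWN resp. UP, for a cosine numerator `c`. [folklore] -/
def Params.opDnZ (P : Params) (c : ℤ) : ℤ := D + fdivZ (2 * P.tpN * c) P.tpD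
/-- `1 + 2t′c/D` rounded UP. [folklore] -/
def Params.opUpZ (P : Params) (c : ℤ) : ℤ := D + cdivZ (2 * P.tpN * c) P.tpD

/-- `S(a) = 2 + 4t′a` (numerator over `D`) rounded UP resp. DOWN. [folklore] -/
def Params.sUpZ (P : Params) (a : ℤ) : ℤ := cdivZ (2 * D * P.tpD + 4 * P.tpN * a) P.tpD
/-- `S(a)` rounded DOWN. [folklore] -/
def Params.sDnZ (P : Params) (a : ℤ) : ℤ := fdivZ (2 * D * P.tpD + 4 * P.tpN * a) P.tpD
/-- Exact positivity test `S(a) > 0`. [folklore] -/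
def Params.sPos (P : Params) (a : ℤ) : Bool := decide (0 < 2 * D * P.tpD + 4 * P.tpN * a)

/-- `b⋆(a) = −(2a + μ)/S(a)` as a numerator over `D`, rounded UP (the same function gives `a⋆(b)` by the symmetry of the band). [folklore] -/
def Params.bStarUpZ (P : Params) (a : ℤ) : ℤ :=
  cdivZ (-(2 * a * P.muD + P.muN * D) * P.tpD * D) (P.muD * (2 * D * P.tpD + 4 * P.tpN * a))
/-- `b⋆(a)` rounded DOWN. [folklore] -/
def Params.bStarDnZ (P : Params) (a : ℤ) : ℤ :=
  fdivZ (-(2 * a * P.muD + P.muN * D) * P.tpD * D) (P.muD * (2 * D * P.tpD + 4 * P.tpN * a))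

/-- `m`-th point of the integer partition of `[u0, u1]` into `M` pieces. [folklore] -/
def linGridZ (u0 u1 : ℤ) (M m : ℕ) : ℤ := u0 + fdivZ ((u1 - u0) * (m : ℤ)) (M : ℤ)

/-- Number of `a`-pieces per boundary cell (both directions). [folklore] -/
def MA : ℕ := 8

/-- CELL DATA computed once per leaf from the four corner records: the eight outer cosine ranges
`(aLo, aUp, bLo, bUp)` of `p`, `(aLo', aUp', bLo', bUp')` of `p + q`, and the four band enclosures
`e1Lo ≤ D ε_p ≤ e1Hi`, `e2Lo ≤ D ε_{p+q} ≤ e2Hi` on the cell. [folklore] -/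
structure Cell where
  /-- `≤ D · inf cos p₀` -/
  aLo : ℤ
  /-- `≥ D · sup cos p₀` -/
  aUp : ℤ
  /-- `≤ D · inf cos p₁` -/
  bLo : ℤ
  /-- `≥ D · sup cos p₁` -/
  bUp : ℤ
  /-- `≤ D · inf cos (p₀+q₁)` -/
  aLo' : ℤ
  /-- `≥ D · sup cos (p₀+q₁)` -/
  aUp' : ℤ
  /-- `≤ D · inf cos (p₁+q₂)` -/
  bLo' : ℤ
  /-- `≥ D · sup cos (p₁+q₂)` -/
  bUp' : ℤ
  /-- `≤ D · inf ε_p` -/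
  e1Lo : ℤ
  /-- `≥ D · sup ε_p` -/
  e1Hi : ℤ
  /-- `≤ D · inf ε_{p+q}` -/
  e2Lo : ℤ
  /-- `≥ D · sup ε_{p+q}` -/
  e2Hi : ℤ
  /-- all eight antitonicity guards hold -/
  guards : Bool

/-- Compute the cell data from the corner records. [folklore] -/
def Params.cell (P : Params) (x0 x1 y0 y1 : Pt) : Cell :=
  let aLo := P.cosInfZ x0.z x1.z x0.lo x1.lo
  let aUp := P.cosSupZ x0.z x1.z x0.hi x1.hi
  let bLo := P.cosInfZ y0.z y1.z y0.lo y1.lo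
  let bUp := P.cosSupZ y0.z y1.z y0.hi y1.hi
  let aLo' := P.cosInfZ (x0.z + P.q1z) (x1.z + P.q1z) x0.lo' x1.lo'
  let aUp' := P.cosSupZ (x0.z + P.q1z) (x1.z + P.q1z) x0.hi' x1.hi'
  let bLo' := P.cosInfZ (y0.z + P.q2z) (y1.z + P.q2z) y0.lo' y1.lo'
  let bUp' := P.cosSupZ (y0.z + P.q2z) (y1.z + P.q2z) y0.hi' y1.hi'
  ⟨aLo, aUp, bLo, bUp, aLo', aUp', bLo', bUp', P.bandDnZ aUp bUp, P.bandUpZ aLo bLo, P.bandDnZ aUp' bUp', P.bandUpZ aLo' bLo',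
    P.guard aLo && P.guard aUp && P.guard bLo && P.guard bUp && P.guard aLo' && P.guard aUp' && P.guard bLo' && P.guard bUp'⟩

/-- Shell status of a point from its band enclosure: `some true` = certified OCCUPIED (`sup ε < μ`), `some false` = certified EMPTY
(`μ ≤ inf ε`), `none` = may straddle. [folklore] -/
def Params.status (P : Params) (eLo eHi : ℤ) : Option Bool :=
  if P.ltMu eHi then some true else if P.muLe eLo then some false else none

/-- Certified lower bound (over `D`, `≥ 0`) of `|ε − μ|` for a point with band enclosure `[eLo, eHi]`: `⌊Dμ⌋ − eHi` if occupied,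
`eLo − ⌈Dμ⌉` if empty, `0` if it may straddle. [folklore] -/
def Params.distLoZ (P : Params) (eLo eHi : ℤ) : ℤ :=
  match P.status eLo eHi with
  | some true => max 0 (P.muFl - eHi)
  | some false => max 0 (eLo - P.muCl)
  | none => 0

/-- Upper bound (over `D`) of `|ε − μ|` on the cell from the band enclosure. [folklore] -/
def Params.distHiZ (P : Params) (eLo eHi : ℤ) : ℤ := max (eHi - P.muFl) (P.muCl - eLo)

end Summit.HubbardSuperconductivity.HubbardSuperconductivity.Theorems.KlLindhardEnclosure

end
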